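import Literature.AnabelianGeometry.Anabelioids.ComponentDecomposition
import Mathlib.CategoryTheory.Comma.Over.Pullback
import HarnessLib

/-!
# Pieces of an object over its connected components (brick G6/G7 toolkit of [SemiAnbd] Def. 2.2 (i))

Mochizuki, *Semi-graphs of anabelioids*, Publ. RIMS **42** (2006), §2 p. 23
[cite: MochizukiSemiAnbd2006, Def. 2.2(i) p.23], with [SGA1, Exp. V §4]: the global clause
`B(𝒢_A) ≃ B(𝒢)_{/A}` of Definition 2.2 (i) ("`B'` itself arises naturally as the `B(−)` of some
semi-graph of anabelioids `𝒢'`") rests on the extensivity of Galois categories: an object `S` of a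
connected anabelioid is the disjoint universal coproduct of its connected components
(`ComponentDecomposition.lean`), so that an object `Y → S` over `S` "is" the family of its pieces
`Y ×_S P → P` over the components `P`.  This proof-side toolkit records that dictionary in the form
consumed by the comparison functor `B(𝒢)_{/A} ⥤ B(𝒢_A)` (`CoveringComparison.lean`), indexing the
components by an arbitrary type `ι` equivalent to the type of connected subobjects (the covering
`𝒢_A` indexes them by `Shrink`-copies):

* `isColimit_cofan_components_equiv`, `isColimit_cofan_pieces` — `S = ∐ᵢ Pᵢ` and `Y = ∐ᵢ Y ×_S Pᵢ`;
* `pieces_hom_ext`, `piecesDesc` — morphisms out of `Y` are determined by, and built from, their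
  restrictions to the pieces;
* `isPullback_ι_assemble` — van Kampen: for a family `Xᵢ → Pᵢ` the coproduct `∐ᵢ Xᵢ → S` has pieces
  `Xᵢ` (`assemblePieceIso`);
* `Over.isoOfPieces` — two objects over `S` with isomorphic pieces are isomorphic over `S`;
* `isInitial_of_hom_to_initial`, `isIso_cofan_inj_of_isInitial` — strict initial objects and
  coproducts all of whose summands but one are initial.
-/

namespace Literature.AnabelianGeometry.Anabelioids

open CategoryTheory CategoryTheory.Limits CategoryTheory.PreGaloisCategory

universe w v₁ u₁

-- Mathlib's `Over.pullback` simp lemmas (`pullback.lift_fst`, …) only fire under the pre-v4.2x defeq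
-- transparency behaviour, exactly as in `Mathlib/CategoryTheory/Comma/Over/Pullback.lean`.
set_option backward.isDefEq.respectTransparency false

variable {C : Type u₁} [Category.{v₁} C] [GaloisCategory C]

/-! ### Strict initial objects; coproducts with initial summands -/

/-- An object admitting a morphism to an initial object is initial (Galois categories are finitary
extensive, hence have strict initial objects). [cite: SGA1, Exp. V §4] -/
theorem isInitial_of_hom_to_initial {X I : C} (hI : IsInitial I) (f : X ⟶ I) : Nonempty (IsInitial X) := by
  haveI := finitaryExtensive_of_galoisCategory C
  haveI := hI.isIso_to f
  exact ⟨hI.ofIso (asIso f).symm⟩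

omit [GaloisCategory C] in
/-- In a colimit cofan all of whose summands except `i₀` are initial, the injection of `i₀` is an
isomorphism. [cite: MochizukiSemiAnbd2006, Def. 2.2(i) p.23] -/
theorem isIso_cofan_inj_of_isInitial {ι : Type w} {f : ι → C} {c : Cofan f} (hc : IsColimit c) (i₀ : ι)
    (h : ∀ i, i ≠ i₀ → Nonempty (IsInitial (f i))) : IsIso (c.inj i₀) := by
  classical
  -- the inverse: identity on the summand `i₀`, the unique map elsewhere
  let k : ∀ i, f i ⟶ f i₀ := fun i =>
    if hi : i = i₀ then eqToHom (congrArg f hi) else (Classical.choice (h i hi)).to _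
  have hk : k i₀ = 𝟙 _ := by simp [k]
  refine ⟨⟨Cofan.IsColimit.desc hc k, ?_, ?_⟩⟩
  · rw [Cofan.IsColimit.fac, hk]
  · refine Cofan.IsColimit.hom_ext hc _ _ fun i => ?_
    rw [Cofan.IsColimit.fac_assoc, Category.comp_id]
    by_cases hi : i = i₀
    · subst hi; rw [hk, Category.id_comp]
    · exact (Classical.choice (h i hi)).hom_ext _ _

/-! ### The component cofan indexed by an equivalent type -/

section Pieces

variable {S : C} {ι : Type w} [Finite ι] (e : ι ≃ {P : Subobject S // IsConnected (P : C)})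

omit [GaloisCategory C] in
/-- A cofan injection transported along an equality of indices. [folklore] -/
private theorem cofan_inj_congr {κ : Type*} {g : κ → C} (s : Cofan g) {j j' : κ} (hj : j = j') :
    s.inj j = eqToHom (congrArg g hj) ≫ s.inj j' := by
  subst hj; simp

omit [Finite ι] in
/-- `S` is the coproduct of its connected components, indexed by any type equivalent to the type of
connected subobjects. [cite: MochizukiSemiAnbd2006, Def. 2.2(i) p.23] -/
theorem isColimit_cofan_components_equiv :
    Nonempty (IsColimit (Cofan.mk S (fun i : ι => (e i).1.arrow))) := by
  obtain ⟨hc⟩ := isColimit_cofan_components S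
  refine ⟨Cofan.IsColimit.mk _
    (fun s => Cofan.IsColimit.desc hc (fun P =>
      eqToHom (congrArg (fun P : {P : Subobject S // IsConnected (P : C)} => ((P.1 : C)))
        (e.apply_symm_apply P).symm) ≫ s.inj (e.symm P)))
    (fun s i => ?_) (fun s m hm => ?_)⟩
  · change (Cofan.mk S (fun P : {P : Subobject S // IsConnected (P : C)} => P.1.arrow)).inj (e i) ≫ _ = _
    rw [Cofan.IsColimit.fac,
      cofan_inj_congr s (g := fun i : ι => ((e i).1 : C)) (e.symm_apply_apply i).symm]
  · refine Cofan.IsColimit.hom_ext hc _ _ fun P => ?_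
    rw [Cofan.IsColimit.fac]
    have hP := hm (e.symm P)
    change (e (e.symm P)).1.arrow ≫ m = s.inj (e.symm P) at hP
    rw [cofan_inj_congr (Cofan.mk S (fun P : {P : Subobject S // IsConnected (P : C)} => P.1.arrow))
      (e.apply_symm_apply P).symm, Category.assoc]
    change eqToHom _ ≫ (e (e.symm P)).1.arrow ≫ m = _
    rw [hP]

/-- Universality: `Y = ∐ᵢ Y ×_S Pᵢ` with injections the first projections.
[cite: MochizukiSemiAnbd2006, Def. 2.2(i) p.23] -/
theorem isColimit_cofan_pieces {Y : C} (f : Y ⟶ S) :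
    Nonempty (IsColimit (Cofan.mk Y (fun i : ι => pullback.fst f (e i).1.arrow))) := by
  haveI := finitaryExtensive_of_galoisCategory C
  obtain ⟨hc⟩ := isColimit_cofan_components_equiv e
  have hU := FinitaryPreExtensive.isUniversal_finiteCoproducts hc
  refine hU (Cofan.mk Y (fun i : ι => pullback.fst f (e i).1.arrow))
    (Discrete.natTrans fun i => pullback.snd f (e i.as).1.arrow) f ?_
    (NatTrans.Equifibered.of_discrete _) fun ⟨i⟩ => ?_
  · ext ⟨i⟩
    change pullback.snd f (e i).1.arrow ≫ (e i).1.arrow = pullback.fst f (e i).1.arrow ≫ f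
    exact pullback.condition.symm
  · exact IsPullback.of_hasPullback f (e i).1.arrow

/-- Morphisms out of `Y → S` are determined by their restrictions to the pieces `Y ×_S Pᵢ`.
[cite: MochizukiSemiAnbd2006, Def. 2.2(i) p.23] -/
theorem pieces_hom_ext {Y Z : C} (f : Y ⟶ S) {g g' : Y ⟶ Z}
    (h : ∀ i : ι, pullback.fst f (e i).1.arrow ≫ g = pullback.fst f (e i).1.arrow ≫ g') : g = g' := by
  obtain ⟨hc⟩ := isColimit_cofan_pieces e f
  exact Cofan.IsColimit.hom_ext hc _ _ fun i => h i

/-- The morphism `Y → Z` with prescribed restrictions to the pieces.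
[cite: MochizukiSemiAnbd2006, Def. 2.2(i) p.23] -/
noncomputable def piecesDesc {Y Z : C} (f : Y ⟶ S) (k : ∀ i : ι, pullback f (e i).1.arrow ⟶ Z) : Y ⟶ Z :=
  Cofan.IsColimit.desc (Classical.choice (isColimit_cofan_pieces e f)) k

/-- The defining property of `piecesDesc`. [cite: MochizukiSemiAnbd2006, Def. 2.2(i) p.23] -/
@[reassoc (attr := simp)]
theorem pullback_fst_piecesDesc {Y Z : C} (f : Y ⟶ S) (k : ∀ i : ι, pullback f (e i).1.arrow ⟶ Z)
    (i : ι) : pullback.fst f (e i).1.arrow ≫ piecesDesc e f k = k i :=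
  Cofan.IsColimit.fac (Classical.choice (isColimit_cofan_pieces e f)) k i

/-! ### Van Kampen: assembling a family over the components -/

variable (X : ∀ i : ι, Over ((e i).1 : C))

/-- The coproduct `∐ᵢ Xᵢ` of a family `Xᵢ → Pᵢ` over the components.
[cite: MochizukiSemiAnbd2006, Def. 2.2(i) p.23] -/
noncomputable def assemble : C := ∐ fun i => (X i).left

/-- Its structure morphism `∐ᵢ Xᵢ → S`. [cite: MochizukiSemiAnbd2006, Def. 2.2(i) p.23] -/
noncomputable def assembleHom : assemble e X ⟶ S := Sigma.desc fun i => (X i).hom ≫ (e i).1.arrow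

/-- `∐ᵢ Xᵢ → S` as an object over `S`. [cite: MochizukiSemiAnbd2006, Def. 2.2(i) p.23] -/
noncomputable abbrev assembleOver : Over S := Over.mk (assembleHom e X)

/-- The structure morphism on the summand `Xᵢ` is `Xᵢ → Pᵢ ↪ S`. [cite: MochizukiSemiAnbd2006, Def. 2.2(i) p.23] -/
@[reassoc (attr := simp)]
theorem ι_assembleHom (i : ι) : Sigma.ι (fun i => (X i).left) i ≫ assembleHom e X = (X i).hom ≫ (e i).1.arrow :=
  Sigma.ι_desc _ _

/-- **Van Kampen**: the summand `Xᵢ` IS the piece of `∐ᵢ Xᵢ → S` over `Pᵢ` (coproducts in a Galois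
category are van Kampen). [cite: MochizukiSemiAnbd2006, Def. 2.2(i) p.23] -/
theorem isPullback_ι_assemble (i : ι) :
    IsPullback (Sigma.ι (fun i => (X i).left) i) (X i).hom (assembleHom e X) (e i).1.arrow := by
  haveI := finitaryExtensive_of_galoisCategory C
  obtain ⟨hc⟩ := isColimit_cofan_components_equiv e
  have H := FinitaryExtensive.isVanKampen_finiteCoproducts hc
  have key := H (Cofan.mk (assemble e X) (Sigma.ι fun i => (X i).left))
    (Discrete.natTrans fun i => (X i.as).hom) (assembleHom e X) ?_
    (NatTrans.Equifibered.of_discrete _)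
  · exact (key.mp ⟨coproductIsCoproduct _⟩) ⟨i⟩
  · ext ⟨i⟩
    change (X i).hom ≫ (e i).1.arrow = Sigma.ι (fun i => (X i).left) i ≫ assembleHom e X
    rw [ι_assembleHom]

/-- The canonical isomorphism `Xᵢ ≅ (∐ᵢ Xᵢ) ×_S Pᵢ`. [cite: MochizukiSemiAnbd2006, Def. 2.2(i) p.23] -/
noncomputable def assemblePieceIso (i : ι) :
    (X i).left ≅ pullback (assembleHom e X) (e i).1.arrow :=
  (isPullback_ι_assemble e X i).isoPullback

/-- First projection of `assemblePieceIso`: the coproduct injection. [cite: MochizukiSemiAnbd2006, Def. 2.2(i) p.23] -/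
@[reassoc (attr := simp)]
theorem assemblePieceIso_hom_fst (i : ι) :
    (assemblePieceIso e X i).hom ≫ pullback.fst _ _ = Sigma.ι (fun i => (X i).left) i :=
  (isPullback_ι_assemble e X i).isoPullback_hom_fst

/-- Second projection of `assemblePieceIso`: the structure morphism `Xᵢ → Pᵢ`. [cite: MochizukiSemiAnbd2006, Def. 2.2(i) p.23] -/
@[reassoc (attr := simp)]
theorem assemblePieceIso_hom_snd (i : ι) :
    (assemblePieceIso e X i).hom ≫ pullback.snd _ _ = (X i).hom :=
  (isPullback_ι_assemble e X i).isoPullback_hom_snd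

/-- `Xᵢ ≅ (∐ᵢ Xᵢ) ×_S Pᵢ` over `Pᵢ`. [cite: MochizukiSemiAnbd2006, Def. 2.2(i) p.23] -/
noncomputable def assemblePieceOverIso (i : ι) :
    X i ≅ (Over.pullback (e i).1.arrow).obj (assembleOver e X) :=
  Over.isoMk (assemblePieceIso e X i) (assemblePieceIso_hom_snd e X i)

/-- The underlying isomorphism of `assemblePieceOverIso`. [cite: MochizukiSemiAnbd2006, Def. 2.2(i) p.23] -/
@[simp]
theorem assemblePieceOverIso_hom_left (i : ι) :
    (assemblePieceOverIso e X i).hom.left = (assemblePieceIso e X i).hom := rfl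

/-! ### Isomorphisms over `S` from isomorphisms of the pieces -/

variable {X}

omit [Finite ι] in
/-- The restriction of a morphism over `S` to a piece, first projection. [cite: MochizukiSemiAnbd2006, Def. 2.2(i) p.23] -/
@[reassoc]
theorem Over.pullback_map_left_fst {Y Y' : Over S} (g : Y ⟶ Y') (i : ι) :
    ((Over.pullback (e i).1.arrow).map g).left ≫ pullback.fst _ _ = pullback.fst _ _ ≫ g.left := by
  simp [Over.pullback_map_left]

omit [Finite ι] in
/-- The restriction of a morphism over `S` to a piece, second projection. [cite: MochizukiSemiAnbd2006, Def. 2.2(i) p.23] -/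
@[reassoc]
theorem Over.pullback_map_left_snd {Y Y' : Over S} (g : Y ⟶ Y') (i : ι) :
    ((Over.pullback (e i).1.arrow).map g).left ≫ pullback.snd _ _ = pullback.snd _ _ := by
  simp [Over.pullback_map_left]

/-- The morphism over `S` with prescribed restrictions to the pieces.
[cite: MochizukiSemiAnbd2006, Def. 2.2(i) p.23] -/
noncomputable def Over.homOfPieces {Y Y' : Over S}
    (η : ∀ i : ι, (Over.pullback (e i).1.arrow).obj Y ⟶ (Over.pullback (e i).1.arrow).obj Y') :
    Y ⟶ Y' :=
  Over.homMk (piecesDesc e Y.hom fun i => (η i).left ≫ pullback.fst _ _) (by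
    refine pieces_hom_ext e Y.hom fun i => ?_
    rw [pullback_fst_piecesDesc_assoc, Category.assoc, pullback.condition, ← Category.assoc]
    have hw : (η i).left ≫ pullback.snd Y'.hom (e i).1.arrow = pullback.snd Y.hom (e i).1.arrow := Over.w (η i)
    rw [hw, pullback.condition])

/-- The defining property of `homOfPieces` on the pieces. [cite: MochizukiSemiAnbd2006, Def. 2.2(i) p.23] -/
@[reassoc (attr := simp)]
theorem pullback_fst_homOfPieces_left {Y Y' : Over S}
    (η : ∀ i : ι, (Over.pullback (e i).1.arrow).obj Y ⟶ (Over.pullback (e i).1.arrow).obj Y') (i : ι) :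
    pullback.fst Y.hom (e i).1.arrow ≫ (Over.homOfPieces e η).left = (η i).left ≫ pullback.fst _ _ := by
  simp [Over.homOfPieces]

/-- `homOfPieces` restricts to the prescribed pieces. [cite: MochizukiSemiAnbd2006, Def. 2.2(i) p.23] -/
theorem Over.pullback_map_homOfPieces {Y Y' : Over S}
    (η : ∀ i : ι, (Over.pullback (e i).1.arrow).obj Y ⟶ (Over.pullback (e i).1.arrow).obj Y') (i : ι) :
    (Over.pullback (e i).1.arrow).map (Over.homOfPieces e η) = η i := by
  ext
  apply pullback.hom_ext
  · rw [Over.pullback_map_left_fst, pullback_fst_homOfPieces_left]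
  · rw [Over.pullback_map_left_snd]
    exact (Over.w (η i)).symm

/-- `homOfPieces` is functorial: composition. [cite: MochizukiSemiAnbd2006, Def. 2.2(i) p.23] -/
theorem Over.homOfPieces_comp {Y Y' Y'' : Over S}
    (η : ∀ i : ι, (Over.pullback (e i).1.arrow).obj Y ⟶ (Over.pullback (e i).1.arrow).obj Y')
    (η' : ∀ i : ι, (Over.pullback (e i).1.arrow).obj Y' ⟶ (Over.pullback (e i).1.arrow).obj Y'') :
    Over.homOfPieces e η ≫ Over.homOfPieces e η' = Over.homOfPieces e (fun i => η i ≫ η' i) := by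
  ext
  refine pieces_hom_ext e Y.hom fun i => ?_
  rw [Over.comp_left, pullback_fst_homOfPieces_left_assoc]
  erw [pullback_fst_homOfPieces_left, pullback_fst_homOfPieces_left]
  rw [Over.comp_left, Category.assoc]

/-- `homOfPieces` of identities is the identity. [cite: MochizukiSemiAnbd2006, Def. 2.2(i) p.23] -/
theorem Over.homOfPieces_id (Y : Over S) :
    Over.homOfPieces e (fun i => 𝟙 ((Over.pullback (e i).1.arrow).obj Y)) = 𝟙 Y := by
  ext
  refine pieces_hom_ext e Y.hom fun i => ?_
  rw [pullback_fst_homOfPieces_left, Over.id_left, Over.id_left, Category.id_comp, Category.comp_id]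

/-- **Two objects over `S` with isomorphic pieces over every component are isomorphic over `S`**, by
an isomorphism restricting to the given ones. [cite: MochizukiSemiAnbd2006, Def. 2.2(i) p.23] -/
noncomputable def Over.isoOfPieces {Y Y' : Over S}
    (η : ∀ i : ι, (Over.pullback (e i).1.arrow).obj Y ≅ (Over.pullback (e i).1.arrow).obj Y') : Y ≅ Y' where
  hom := Over.homOfPieces e fun i => (η i).hom
  inv := Over.homOfPieces e fun i => (η i).inv
  hom_inv_id := by rw [Over.homOfPieces_comp]; simp only [Iso.hom_inv_id]; exact Over.homOfPieces_id e Y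
  inv_hom_id := by rw [Over.homOfPieces_comp]; simp only [Iso.inv_hom_id]; exact Over.homOfPieces_id e Y'

/-- The defining property of `isoOfPieces` on the pieces. [cite: MochizukiSemiAnbd2006, Def. 2.2(i) p.23] -/
@[reassoc (attr := simp)]
theorem pullback_fst_isoOfPieces_hom_left {Y Y' : Over S}
    (η : ∀ i : ι, (Over.pullback (e i).1.arrow).obj Y ≅ (Over.pullback (e i).1.arrow).obj Y') (i : ι) :
    pullback.fst Y.hom (e i).1.arrow ≫ (Over.isoOfPieces e η).hom.left = (η i).hom.left ≫ pullback.fst _ _ :=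
  pullback_fst_homOfPieces_left e _ i

/-- `isoOfPieces` restricts to the given isomorphisms of pieces. [cite: MochizukiSemiAnbd2006, Def. 2.2(i) p.23] -/
theorem Over.pullback_map_isoOfPieces_hom {Y Y' : Over S}
    (η : ∀ i : ι, (Over.pullback (e i).1.arrow).obj Y ≅ (Over.pullback (e i).1.arrow).obj Y') (i : ι) :
    (Over.pullback (e i).1.arrow).map (Over.isoOfPieces e η).hom = (η i).hom :=
  Over.pullback_map_homOfPieces e _ i

end Pieces

end Literature.AnabelianGeometry.Anabelioids
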